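import Mathlib
import Summits.SmoothPoincare4.SmoothPoincare4.Theses.SullivanDual
import Summits.SmoothPoincare4.SmoothPoincare4.Theorems.SullivanDualHyperbolicEndStubAhlforsOsserman
import Summits.SmoothPoincare4.SmoothPoincare4.Theorems.SullivanDualHyperbolicEndStubSubMeanValueLiouville
import Summits.SmoothPoincare4.SmoothPoincare4.Theorems.SullivanDualHyperbolicEndStubCollarLiouville
import Summits.SmoothPoincare4.SmoothPoincare4.Theorems.SullivanDualHyperbolicEndStubModelPair
import Summits.SmoothPoincare4.SmoothPoincare4.Theorems.SullivanDualHyperbolicEndStandardSphere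
import Summits.SmoothPoincare4.SmoothPoincare4.Theorems.SullivanDualHyperbolicEndStubTransportToChart
import Summits.SmoothPoincare4.SmoothPoincare4.Theorems.SullivanDualHyperbolicEndStubGlueFromChart
import Literature.Geometry.Symplectic.JHolomorphicMap
import Literature.Geometry.Symplectic.ExactNoJSpheres
import HarnessLib

/-!
# Skeleton — crux `HyperbolicEnd` (stmt-SmoothPoincare4-7825), line `Sketch`
(idea card `Cruxes/HyperbolicEnd/Ideas/hyperbolic-crumpling.md`; lead cycle 2 reshape; cycle 4 negative-side note under K1)

State. The four analytic/model stubs of cycle 1 are LANDED and imported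
(`…StubAhlforsOsserman` p106332, `…StubSubMeanValueLiouville` p106265, `…StubCollarLiouville`
p106351, `…StubModelPair` p106451; standard-sphere case `…StandardSphere` p107038). The former
load-bearing stub `stub_hyperbolicPair` (K1 + K2 + K3 + admissible `J` of the card in one
existential) is RESHAPED (cycle 2) into three registered stubs that separate the Σ-dependent but
printed step from the Σ-free conjecture, in the tree's certificate interface (a pair `(J, F)`,
`F` a pointwise positive-definite function on tangent vectors, whose density
`λ_f = F(f, ∂ₓf)` along every LOCAL `J`-holomorphic map `f` is `C²` with
`λ Δλ - |∇λ|² ≥ 2c λ³` — "holomorphic curvature `≤ -c`" in Royden–Wong form; no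
almost-Hermitian vocabulary is needed):

* `stub_punctureCertificate` (K2 ∘ K3 + admissible `J`; Σ-dependent, PRINTED): every punctured
  homotopy `4`-sphere carries an admissible `J`, an interior closed chart ball
  `b = e_q⁻¹(closedBall (e_q q) r₁)` of the core (inside a larger chart ball of radius `r₃` that
  misses `p` and the collar) and a smooth positive-definite `F` on `T(Σ∖p)` such that the
  certificate holds along every local `J`-curve into the core that avoids `b`. Proof on paper:
  extend the standard collar structure to an admissible `J` (obstruction in `π₃(S²)` vanishes,
  route support `AdmissibleJExists`); on the OPEN manifold `V = (Σ∖p) ∖ b` the relation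
  `𝒦_{(g,J)} ≤ -c` for almost-Hermitian pairs — `𝒦(X) = Sec_g(X ∧ JX) + |Q(X)|²/8 - |P(X)|²`,
  `P = ((∇_X J)X)^⊥`, `Q = ((∇_{JX}J)X + J(∇_XJ)X)^⊥ + 2JP`, the sharp upper bound for the Gauss
  curvature of `J`-curves tangent to `X` given by the Gauss equation (this replaces Kobayashi's
  canonical-connection lemma, card K3) — is open, `Diff`-invariant, affine in `∂²g` with
  non-empty convex fibres, so Gromov's h-principle for open invariant relations on open manifolds,
  relative to the collar where the complex-hyperbolic Kähler model (`𝒦 ≡ -const`) is kept, gives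
  `(g̃, J̃)` on `V` (the free region `int K ∖ b` exits through `∂b`); `F = g̃(v, v)` extended
  smoothly, `J̃` extended smoothly over `b` (it is homotopic to `J` rel collar).
* `stub_certificateFill` (K1, the Σ-FREE conjecture, flat statement on `ℝ⁴`): a certificate
  `(J, F, c)` on a shell `r₁ < |x - a| < r₃`, with `J` almost complex on the whole ball
  `B(a, r₃)` and `F` smooth and positive definite on the shell, can be FILLED: some `(J', F', c')`
  agreeing with `(J, F)` on the outer shell `r₂ < |x - a| < r₃` is a certificate on all of
  `B(a, r₃)` ("hyperbolic ball-filling"; true for the model germ by `stub_modelPair`; no filling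
  invariant of certified germs is known — this is where the line lives or dies).
  NEGATIVE SIDE (lead c3, cycle 4, kernel-checked under `Theorems/HyperbolicEnd/Negative/`): the
  freedom in `J'` is ESSENTIAL — this statement with the filling's structure frozen (`J' := J`)
  is FALSE already for `J = J₀ = stdComplexStructure`, `a = 0`, `(r₁, r₂, r₃) = (1, 2, 4)`
  (`helper_certificateFill_frozen_false`, FrozenFillE4.lean p130626: certified shell germ
  `e^{2ψ_M}‖v‖²`, `ψ_M = -8χ(q₂) log(q₁ + 10⁻³) + M q₂ + q₁ + q₂`, with negative flux along the
  first complex line; Schwarz growth bound + strip maximum principle along `w ↦ e^w`), and in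
  complex dimension one (`helper_frozenFillDim1_false`, FrozenFill.lean p128824: the neck
  `(1 + 81/|x|⁴)|v|²`, closed geodesic at `|x| = 3`). Any filling must rotate `J'` on
  `closedBall a r₂` so that no low-genus `J'`-curve caps the flat discs through the hole.
* `stub_transportToChart` (G1, provable now) and `stub_glueFromChart` (G2, provable now): chart
  transport of `(J, F)` to the flat ball `B(e_q q, r₃)` (linked by the chart differential), and
  transport back + gluing of a filled flat triple with `(J, F)` off `e_q⁻¹(closedBall r₂)`; the
  certificate is local (open cover `{core ∖ e_q⁻¹ closedBall r₂, e_q⁻¹ ball r₃}` of the core)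
  and invariant under diffeomorphisms, so the glued pair is a certificate on the whole core with
  constant `min c c'`; admissibility is untouched because the chart ball misses the collar.
  `certificateGlue` (proved here from G1, G2) feeds K1 between them.
* `hyperbolicPair` := glue (puncture) (fill) — the conclusion of the former `stub_hyperbolicPair`.
* glue to the crux (`HyperbolicEnd_of`, unchanged from cycle 1): an entire curve avoiding `B_ε`
  avoids `B_ε'` (`stub_collarLiouville` fed with `stub_subMeanValueLiouville`), its density
  satisfies the Ahlfors inequality on all of `ℂ` and is `≥ 0`, hence vanishes
  (`stub_ahlforsOsserman`); positivity of `F` gives `∂u/∂x ≡ 0`, `J`-holomorphicity `du ≡ 0`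
  (`mfderiv_eq_zero_of_apply_one_eq_zero`), so `u` is constant
  (`apply_eq_apply_zero_of_mfderiv_eq_zero`) — contradiction.
-/

noncomputable section

-- the prescribed crux namespace repeats the component `SmoothPoincare4`
set_option linter.dupNamespace false

open scoped Manifold ContDiff Topology
open Laplacian Set
open Literature.Geometry.Symplectic Literature.Topology.FourManifolds

namespace Summit.SmoothPoincare4.SmoothPoincare4.Cruxes.HyperbolicEnd.Sketch

/-- **Stub (K2 ∘ K3 + admissible `J`) — the puncture certificate (Σ-dependent, printed).**
Every punctured homotopy `4`-sphere `Σ ∖ p` carries an ADMISSIBLE `J` (radius `ε' > 0` with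
`closedBall (e p) ε'` in the chart target, `J² = -1`, `J` smooth, `J` standard on the punctured
ball `B_ε'`), a point `q` with chart `e_q = extChartAt q` and radii `0 < r₁ < r₃` such that the
closed chart ball `closedBall (e_q q) r₃` lies in the chart target, misses `p`, and its preimage
lies in the core `Σ ∖ (p ∪ B_ε')`, a constant `c > 0` and a function `F` on tangent vectors,
smooth on the tangent bundle and positive definite, such that along every local `J`-holomorphic
map `f : U → Σ ∖ p` (`U ⊆ ℂ` open) whose image avoids the collar `B_ε'` AND the inner chart ball
`e_q⁻¹ (closedBall (e_q q) r₁)`, the density `λ z = F (f z) (∂f/∂x (z))` is `C²` on `U` and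
satisfies `2c λ³ ≤ λ Δλ - |∇λ|²` there. On paper: Gromov's h-principle for the open
`Diff`-invariant relation `𝒦 ≤ -c` (sharp Gauss-equation bound for the curvature of `J`-curves
of an almost-Hermitian pair) on the open manifold `(Σ ∖ p) ∖ b`, relative to the
complex-hyperbolic collar model; `F = g̃(·,·)`. [Gromov 1986 §2.2/§2.4; Eliashberg–Mishachev
2002 Thm 7.2.4; Kobayashi 2001] -/
theorem stub_punctureCertificate :
    ∀ (S : HomotopySphere 4) (p : S.carrier),
    ∃ (J : ∀ x : ↥(punctured p), TangentSpace (𝓡 4) x →L[ℝ] TangentSpace (𝓡 4) x) (ε' : ℝ)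
      (F : ∀ x : ↥(punctured p), TangentSpace (𝓡 4) x → ℝ) (c : ℝ) (q : S.carrier) (r₁ r₃ : ℝ),
      0 < ε' ∧ Metric.closedBall (extChartAt (𝓡 4) p p) ε' ⊆ (extChartAt (𝓡 4) p).target ∧
      (∀ (x : ↥(punctured p)) (v : TangentSpace (𝓡 4) x), J x (J x v) = -v) ∧
      (∀ x₀ : ↥(punctured p), ContMDiffAt (𝓡 4)
        𝓘(ℝ, EuclideanSpace ℝ (Fin 4) →L[ℝ] EuclideanSpace ℝ (Fin 4)) ∞
        (inTangentCoordinates (𝓡 4) (𝓡 4) (id : ↥(punctured p) → ↥(punctured p)) id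
          (fun x => J x) x₀) x₀) ∧
      (∀ x : ↥(punctured p), InPuncturedChartBall p ε' x →
        ∀ (v : TangentSpace (𝓡 4) x) (b : EuclideanSpace ℝ (Fin 4)),
          inner ℝ (fderiv ℝ inversion (extChartAt (𝓡 4) p x.1 - extChartAt (𝓡 4) p p)
            (mfderiv (𝓡 4) 𝓘(ℝ, EuclideanSpace ℝ (Fin 4))
              (fun z : ↥(punctured p) => extChartAt (𝓡 4) p z.1) x (J x v))) b =
          stdSymplecticForm (fderiv ℝ inversion (extChartAt (𝓡 4) p x.1 - extChartAt (𝓡 4) p p)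
            (mfderiv (𝓡 4) 𝓘(ℝ, EuclideanSpace ℝ (Fin 4))
              (fun z : ↥(punctured p) => extChartAt (𝓡 4) p z.1) x v)) b) ∧
      0 < c ∧ 0 < r₁ ∧ r₁ < r₃ ∧
      Metric.closedBall (extChartAt (𝓡 4) q q) r₃ ⊆ (extChartAt (𝓡 4) q).target ∧
      (∀ y ∈ Metric.closedBall (extChartAt (𝓡 4) q q) r₃, (extChartAt (𝓡 4) q).symm y ≠ p) ∧
      (∀ x : ↥(punctured p), x.1 ∈ (chartAt (EuclideanSpace ℝ (Fin 4)) q).source →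
        extChartAt (𝓡 4) q x.1 ∈ Metric.closedBall (extChartAt (𝓡 4) q q) r₃ →
        ¬ InPuncturedChartBall p ε' x) ∧
      ContMDiff (𝓡 4).tangent 𝓘(ℝ, ℝ) ∞
        (fun v : TangentBundle (𝓡 4) ↥(punctured p) => F v.proj v.snd) ∧
      (∀ (x : ↥(punctured p)) (v : TangentSpace (𝓡 4) x), 0 ≤ F x v ∧ (F x v = 0 → v = 0)) ∧
      (∀ (U : Set ℂ) (f : ℂ → ↥(punctured p)), IsOpen U →
        ContMDiffOn 𝓘(ℝ, ℂ) (𝓡 4) ∞ f U →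
        (∀ z ∈ U, ∀ ζ : ℂ, mfderiv 𝓘(ℝ, ℂ) (𝓡 4) f z (Complex.I * ζ : ℂ) =
          J (f z) (mfderiv 𝓘(ℝ, ℂ) (𝓡 4) f z (ζ : ℂ))) →
        (∀ z ∈ U, ¬ InPuncturedChartBall p ε' (f z)) →
        (∀ z ∈ U, (f z).1 ∈ (chartAt (EuclideanSpace ℝ (Fin 4)) q).source →
            extChartAt (𝓡 4) q (f z).1 ∉ Metric.closedBall (extChartAt (𝓡 4) q q) r₁) →
        ContDiffOn ℝ 2 (fun w => F (f w) (mfderiv 𝓘(ℝ, ℂ) (𝓡 4) f w (1 : ℂ))) U ∧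
        ∀ z ∈ U, 2 * c * (F (f z) (mfderiv 𝓘(ℝ, ℂ) (𝓡 4) f z (1 : ℂ))) ^ 3 ≤
          F (f z) (mfderiv 𝓘(ℝ, ℂ) (𝓡 4) f z (1 : ℂ)) *
              (Δ (fun w => F (f w) (mfderiv 𝓘(ℝ, ℂ) (𝓡 4) f w (1 : ℂ)))) z -
            ((fderiv ℝ (fun w => F (f w) (mfderiv 𝓘(ℝ, ℂ) (𝓡 4) f w (1 : ℂ))) z 1) ^ 2 +
              (fderiv ℝ (fun w => F (f w) (mfderiv 𝓘(ℝ, ℂ) (𝓡 4) f w (1 : ℂ))) z Complex.I) ^ 2)) := by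
  sorry

/-- **Stub (K1) — hyperbolic ball-filling for certificates (the Σ-free conjecture, flat).**
On `ℝ⁴`: let `J` be a smooth almost complex structure on the ball `B(a, r₃)`, `F` smooth and
positive definite on the shell `A = B(a, r₃) ∖ closedBall a r₁`, and suppose `(J, F, c)` is a
certificate on `A`: along every local `J`-holomorphic `g : U → A` (`U ⊆ ℂ` open, `g` smooth on
`U`, `∂g/∂y = J(g) ∂g/∂x`) the density `λ = F(g, ∂ₓg)` is `C²` with `2c λ³ ≤ λ Δλ - |∇λ|²`. Then
the certificate can be FILLED: there are `J'` (smooth almost complex on `B(a, r₃)`), `F'`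
(positive definite on `B(a, r₃)`) and `c' > 0` with `(J', F') = (J, F)` on the outer shell
`B(a, r₃) ∖ closedBall a r₂` and `(J', F', c')` a certificate on all of `B(a, r₃)`. True for the
model germ (`stub_modelPair`); open in general (idea card K1: no filling invariant of certified
germs is known; a tame filling would make certified germs symplectically fillable, which is not
claimed). -/
theorem stub_certificateFill :
    ∀ (J : EuclideanSpace ℝ (Fin 4) → EuclideanSpace ℝ (Fin 4) →L[ℝ] EuclideanSpace ℝ (Fin 4))
    (F : EuclideanSpace ℝ (Fin 4) → EuclideanSpace ℝ (Fin 4) → ℝ) (a : EuclideanSpace ℝ (Fin 4))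
    (r₁ r₂ r₃ c : ℝ), 0 < r₁ → r₁ < r₂ → r₂ < r₃ → 0 < c →
    ContDiffOn ℝ ∞ J (Metric.ball a r₃) →
    (∀ x ∈ Metric.ball a r₃, ∀ v, J x (J x v) = -v) →
    ContDiffOn ℝ ∞ (fun y : (EuclideanSpace ℝ (Fin 4)) × (EuclideanSpace ℝ (Fin 4)) => F y.1 y.2)
      ((Metric.ball a r₃ \ Metric.closedBall a r₁) ×ˢ Set.univ) →
    (∀ x ∈ Metric.ball a r₃ \ Metric.closedBall a r₁, ∀ v,
      0 ≤ F x v ∧ (F x v = 0 → v = 0)) →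
    (∀ (U : Set ℂ) (g : ℂ → EuclideanSpace ℝ (Fin 4)), IsOpen U →
      ContDiffOn ℝ ∞ g U →
      (∀ z ∈ U, ∀ ζ : ℂ,
        fderiv ℝ g z (Complex.I * ζ) = J (g z) (fderiv ℝ g z ζ)) →
      (∀ z ∈ U, g z ∈
        Metric.ball a r₃ \ Metric.closedBall a r₁) →
      ContDiffOn ℝ 2 (fun w => F (g w) (fderiv ℝ g w 1)) U ∧
      ∀ z ∈ U, 2 * c * (F (g z) (fderiv ℝ g z 1)) ^ 3 ≤
        F (g z) (fderiv ℝ g z 1) * (Δ (fun w => F (g w) (fderiv ℝ g w 1))) z -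
          ((fderiv ℝ (fun w => F (g w) (fderiv ℝ g w 1)) z 1) ^ 2 +
            (fderiv ℝ (fun w => F (g w) (fderiv ℝ g w 1)) z Complex.I) ^ 2)) →
    ∃ (J' : EuclideanSpace ℝ (Fin 4) → EuclideanSpace ℝ (Fin 4) →L[ℝ] EuclideanSpace ℝ (Fin 4))
      (F' : EuclideanSpace ℝ (Fin 4) → EuclideanSpace ℝ (Fin 4) → ℝ) (c' : ℝ),
      0 < c' ∧
      ContDiffOn ℝ ∞ J' (Metric.ball a r₃) ∧
      (∀ x ∈ Metric.ball a r₃, ∀ v, J' x (J' x v) = -v) ∧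
      (∀ x ∈ Metric.ball a r₃ \ Metric.closedBall a r₂,
        J' x = J x ∧ ∀ v, F' x v = F x v) ∧
      (∀ x ∈ Metric.ball a r₃, ∀ v, 0 ≤ F' x v ∧ (F' x v = 0 → v = 0)) ∧
      (∀ (U : Set ℂ) (g : ℂ → EuclideanSpace ℝ (Fin 4)), IsOpen U →
        ContDiffOn ℝ ∞ g U →
        (∀ z ∈ U, ∀ ζ : ℂ,
          fderiv ℝ g z (Complex.I * ζ) = J' (g z) (fderiv ℝ g z ζ)) →
        (∀ z ∈ U, g z ∈
          Metric.ball a r₃) →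
        ContDiffOn ℝ 2 (fun w => F' (g w) (fderiv ℝ g w 1)) U ∧
        ∀ z ∈ U, 2 * c' * (F' (g z) (fderiv ℝ g z 1)) ^ 3 ≤
          F' (g z) (fderiv ℝ g z 1) * (Δ (fun w => F' (g w) (fderiv ℝ g w 1))) z -
            ((fderiv ℝ (fun w => F' (g w) (fderiv ℝ g w 1)) z 1) ^ 2 +
              (fderiv ℝ (fun w => F' (g w) (fderiv ℝ g w 1)) z Complex.I) ^ 2)) := by
  sorry

-- `stub_transportToChart`: LANDED p112350 (imported from Theorems/; see the skeleton docstring)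

-- `stub_glueFromChart`: LANDED p113029 (imported from Theorems/; see the skeleton docstring)

/-- **Glue (derived from G1, K1, G2).** Puncture certificate and filling lemma give the
hyperbolic pair: transport to the chart (G1), fill with `r₂ = (r₁ + r₃)/2` (K1; the filled pair
agrees with the transported one on the outer shell, hence is linked to `(J, F)` there), glue
back (G2). -/
theorem certificateGlue :
    (∀ (S : HomotopySphere 4) (p : S.carrier),
      ∃ (J : ∀ x : ↥(punctured p), TangentSpace (𝓡 4) x →L[ℝ] TangentSpace (𝓡 4) x) (ε' : ℝ)
        (F : ∀ x : ↥(punctured p), TangentSpace (𝓡 4) x → ℝ) (c : ℝ) (q : S.carrier) (r₁ r₃ : ℝ),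
        0 < ε' ∧ Metric.closedBall (extChartAt (𝓡 4) p p) ε' ⊆ (extChartAt (𝓡 4) p).target ∧
        (∀ (x : ↥(punctured p)) (v : TangentSpace (𝓡 4) x), J x (J x v) = -v) ∧
        (∀ x₀ : ↥(punctured p), ContMDiffAt (𝓡 4)
          𝓘(ℝ, EuclideanSpace ℝ (Fin 4) →L[ℝ] EuclideanSpace ℝ (Fin 4)) ∞
          (inTangentCoordinates (𝓡 4) (𝓡 4) (id : ↥(punctured p) → ↥(punctured p)) id
            (fun x => J x) x₀) x₀) ∧
        (∀ x : ↥(punctured p), InPuncturedChartBall p ε' x →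
          ∀ (v : TangentSpace (𝓡 4) x) (b : EuclideanSpace ℝ (Fin 4)),
            inner ℝ (fderiv ℝ inversion (extChartAt (𝓡 4) p x.1 - extChartAt (𝓡 4) p p)
              (mfderiv (𝓡 4) 𝓘(ℝ, EuclideanSpace ℝ (Fin 4))
                (fun z : ↥(punctured p) => extChartAt (𝓡 4) p z.1) x (J x v))) b =
            stdSymplecticForm (fderiv ℝ inversion (extChartAt (𝓡 4) p x.1 - extChartAt (𝓡 4) p p)
              (mfderiv (𝓡 4) 𝓘(ℝ, EuclideanSpace ℝ (Fin 4))
                (fun z : ↥(punctured p) => extChartAt (𝓡 4) p z.1) x v)) b) ∧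
        0 < c ∧ 0 < r₁ ∧ r₁ < r₃ ∧
        Metric.closedBall (extChartAt (𝓡 4) q q) r₃ ⊆ (extChartAt (𝓡 4) q).target ∧
        (∀ y ∈ Metric.closedBall (extChartAt (𝓡 4) q q) r₃, (extChartAt (𝓡 4) q).symm y ≠ p) ∧
        (∀ x : ↥(punctured p), x.1 ∈ (chartAt (EuclideanSpace ℝ (Fin 4)) q).source →
          extChartAt (𝓡 4) q x.1 ∈ Metric.closedBall (extChartAt (𝓡 4) q q) r₃ →
          ¬ InPuncturedChartBall p ε' x) ∧
        ContMDiff (𝓡 4).tangent 𝓘(ℝ, ℝ) ∞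
          (fun v : TangentBundle (𝓡 4) ↥(punctured p) => F v.proj v.snd) ∧
        (∀ (x : ↥(punctured p)) (v : TangentSpace (𝓡 4) x), 0 ≤ F x v ∧ (F x v = 0 → v = 0)) ∧
        (∀ (U : Set ℂ) (f : ℂ → ↥(punctured p)), IsOpen U →
          ContMDiffOn 𝓘(ℝ, ℂ) (𝓡 4) ∞ f U →
          (∀ z ∈ U, ∀ ζ : ℂ, mfderiv 𝓘(ℝ, ℂ) (𝓡 4) f z (Complex.I * ζ : ℂ) =
            J (f z) (mfderiv 𝓘(ℝ, ℂ) (𝓡 4) f z (ζ : ℂ))) →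
          (∀ z ∈ U, ¬ InPuncturedChartBall p ε' (f z)) →
          (∀ z ∈ U, (f z).1 ∈ (chartAt (EuclideanSpace ℝ (Fin 4)) q).source →
              extChartAt (𝓡 4) q (f z).1 ∉ Metric.closedBall (extChartAt (𝓡 4) q q) r₁) →
          ContDiffOn ℝ 2 (fun w => F (f w) (mfderiv 𝓘(ℝ, ℂ) (𝓡 4) f w (1 : ℂ))) U ∧
          ∀ z ∈ U, 2 * c * (F (f z) (mfderiv 𝓘(ℝ, ℂ) (𝓡 4) f z (1 : ℂ))) ^ 3 ≤
            F (f z) (mfderiv 𝓘(ℝ, ℂ) (𝓡 4) f z (1 : ℂ)) *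
                (Δ (fun w => F (f w) (mfderiv 𝓘(ℝ, ℂ) (𝓡 4) f w (1 : ℂ)))) z -
              ((fderiv ℝ (fun w => F (f w) (mfderiv 𝓘(ℝ, ℂ) (𝓡 4) f w (1 : ℂ))) z 1) ^ 2 +
                (fderiv ℝ (fun w => F (f w) (mfderiv 𝓘(ℝ, ℂ) (𝓡 4) f w (1 : ℂ))) z Complex.I) ^ 2))) →
    (∀ (J : EuclideanSpace ℝ (Fin 4) → EuclideanSpace ℝ (Fin 4) →L[ℝ] EuclideanSpace ℝ (Fin 4))
      (F : EuclideanSpace ℝ (Fin 4) → EuclideanSpace ℝ (Fin 4) → ℝ) (a : EuclideanSpace ℝ (Fin 4))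
      (r₁ r₂ r₃ c : ℝ), 0 < r₁ → r₁ < r₂ → r₂ < r₃ → 0 < c →
      ContDiffOn ℝ ∞ J (Metric.ball a r₃) →
      (∀ x ∈ Metric.ball a r₃, ∀ v, J x (J x v) = -v) →
      ContDiffOn ℝ ∞ (fun y : (EuclideanSpace ℝ (Fin 4)) × (EuclideanSpace ℝ (Fin 4)) => F y.1 y.2)
        ((Metric.ball a r₃ \ Metric.closedBall a r₁) ×ˢ Set.univ) →
      (∀ x ∈ Metric.ball a r₃ \ Metric.closedBall a r₁, ∀ v,
        0 ≤ F x v ∧ (F x v = 0 → v = 0)) →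
      (∀ (U : Set ℂ) (g : ℂ → EuclideanSpace ℝ (Fin 4)), IsOpen U →
        ContDiffOn ℝ ∞ g U →
        (∀ z ∈ U, ∀ ζ : ℂ,
          fderiv ℝ g z (Complex.I * ζ) = J (g z) (fderiv ℝ g z ζ)) →
        (∀ z ∈ U, g z ∈
          Metric.ball a r₃ \ Metric.closedBall a r₁) →
        ContDiffOn ℝ 2 (fun w => F (g w) (fderiv ℝ g w 1)) U ∧
        ∀ z ∈ U, 2 * c * (F (g z) (fderiv ℝ g z 1)) ^ 3 ≤
          F (g z) (fderiv ℝ g z 1) * (Δ (fun w => F (g w) (fderiv ℝ g w 1))) z -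
            ((fderiv ℝ (fun w => F (g w) (fderiv ℝ g w 1)) z 1) ^ 2 +
              (fderiv ℝ (fun w => F (g w) (fderiv ℝ g w 1)) z Complex.I) ^ 2)) →
      ∃ (J' : EuclideanSpace ℝ (Fin 4) → EuclideanSpace ℝ (Fin 4) →L[ℝ] EuclideanSpace ℝ (Fin 4))
        (F' : EuclideanSpace ℝ (Fin 4) → EuclideanSpace ℝ (Fin 4) → ℝ) (c' : ℝ),
        0 < c' ∧
        ContDiffOn ℝ ∞ J' (Metric.ball a r₃) ∧
        (∀ x ∈ Metric.ball a r₃, ∀ v, J' x (J' x v) = -v) ∧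
        (∀ x ∈ Metric.ball a r₃ \ Metric.closedBall a r₂,
          J' x = J x ∧ ∀ v, F' x v = F x v) ∧
        (∀ x ∈ Metric.ball a r₃, ∀ v, 0 ≤ F' x v ∧ (F' x v = 0 → v = 0)) ∧
        (∀ (U : Set ℂ) (g : ℂ → EuclideanSpace ℝ (Fin 4)), IsOpen U →
          ContDiffOn ℝ ∞ g U →
          (∀ z ∈ U, ∀ ζ : ℂ,
            fderiv ℝ g z (Complex.I * ζ) = J' (g z) (fderiv ℝ g z ζ)) →
          (∀ z ∈ U, g z ∈
            Metric.ball a r₃) →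
          ContDiffOn ℝ 2 (fun w => F' (g w) (fderiv ℝ g w 1)) U ∧
          ∀ z ∈ U, 2 * c' * (F' (g z) (fderiv ℝ g z 1)) ^ 3 ≤
            F' (g z) (fderiv ℝ g z 1) * (Δ (fun w => F' (g w) (fderiv ℝ g w 1))) z -
              ((fderiv ℝ (fun w => F' (g w) (fderiv ℝ g w 1)) z 1) ^ 2 +
                (fderiv ℝ (fun w => F' (g w) (fderiv ℝ g w 1)) z Complex.I) ^ 2))) →
    ∀ (S : HomotopySphere 4) (p : S.carrier),
    ∃ (J : ∀ x : ↥(punctured p), TangentSpace (𝓡 4) x →L[ℝ] TangentSpace (𝓡 4) x) (ε' c : ℝ)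
      (F : ∀ x : ↥(punctured p), TangentSpace (𝓡 4) x → ℝ),
      0 < ε' ∧ Metric.closedBall (extChartAt (𝓡 4) p p) ε' ⊆ (extChartAt (𝓡 4) p).target ∧
      (∀ (x : ↥(punctured p)) (v : TangentSpace (𝓡 4) x), J x (J x v) = -v) ∧
      (∀ x₀ : ↥(punctured p), ContMDiffAt (𝓡 4)
        𝓘(ℝ, EuclideanSpace ℝ (Fin 4) →L[ℝ] EuclideanSpace ℝ (Fin 4)) ∞
        (inTangentCoordinates (𝓡 4) (𝓡 4) (id : ↥(punctured p) → ↥(punctured p)) id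
          (fun x => J x) x₀) x₀) ∧
      (∀ x : ↥(punctured p), InPuncturedChartBall p ε' x →
        ∀ (v : TangentSpace (𝓡 4) x) (b : EuclideanSpace ℝ (Fin 4)),
          inner ℝ (fderiv ℝ inversion (extChartAt (𝓡 4) p x.1 - extChartAt (𝓡 4) p p)
            (mfderiv (𝓡 4) 𝓘(ℝ, EuclideanSpace ℝ (Fin 4))
              (fun z : ↥(punctured p) => extChartAt (𝓡 4) p z.1) x (J x v))) b =
          stdSymplecticForm (fderiv ℝ inversion (extChartAt (𝓡 4) p x.1 - extChartAt (𝓡 4) p p)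
            (mfderiv (𝓡 4) 𝓘(ℝ, EuclideanSpace ℝ (Fin 4))
              (fun z : ↥(punctured p) => extChartAt (𝓡 4) p z.1) x v)) b) ∧
      0 < c ∧
      (∀ x : ↥(punctured p), ¬ InPuncturedChartBall p ε' x →
        ∀ v : TangentSpace (𝓡 4) x, 0 ≤ F x v ∧ (F x v = 0 → v = 0)) ∧
      (∀ (U : Set ℂ) (f : ℂ → ↥(punctured p)), IsOpen U →
        ContMDiffOn 𝓘(ℝ, ℂ) (𝓡 4) ∞ f U →
        (∀ z ∈ U, ∀ ζ : ℂ, mfderiv 𝓘(ℝ, ℂ) (𝓡 4) f z (Complex.I * ζ : ℂ) =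
          J (f z) (mfderiv 𝓘(ℝ, ℂ) (𝓡 4) f z (ζ : ℂ))) →
        (∀ z ∈ U, ¬ InPuncturedChartBall p ε' (f z)) →
        ContDiffOn ℝ 2 (fun w => F (f w) (mfderiv 𝓘(ℝ, ℂ) (𝓡 4) f w (1 : ℂ))) U ∧
        ∀ z ∈ U, 2 * c * (F (f z) (mfderiv 𝓘(ℝ, ℂ) (𝓡 4) f z (1 : ℂ))) ^ 3 ≤
          F (f z) (mfderiv 𝓘(ℝ, ℂ) (𝓡 4) f z (1 : ℂ)) *
              (Δ (fun w => F (f w) (mfderiv 𝓘(ℝ, ℂ) (𝓡 4) f w (1 : ℂ)))) z -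
            ((fderiv ℝ (fun w => F (f w) (mfderiv 𝓘(ℝ, ℂ) (𝓡 4) f w (1 : ℂ))) z 1) ^ 2 +
              (fderiv ℝ (fun w => F (f w) (mfderiv 𝓘(ℝ, ℂ) (𝓡 4) f w (1 : ℂ))) z Complex.I) ^ 2)) := by
  intro hP hK S p
  obtain ⟨J, ε', F, c, q, r₁, r₃, hdata⟩ := hP S p
  obtain ⟨Jh, Fh, hJh, hJh2, hFh, hFpos, hcert, hlink⟩ :=
    stub_transportToChart S p J ε' F c q r₁ r₃ hdata
  obtain ⟨hε', hball, hJ2, hJs, hJstd, hc, hr₁, hr₁₃, hrest⟩ := hdata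
  have hr₂ : r₁ < (r₁ + r₃) / 2 := by linarith
  have hr₂' : (r₁ + r₃) / 2 < r₃ := by linarith
  obtain ⟨Jh', Fh', c', hc', hJh', hJh'2, hagree, hFh'pos, hcert'⟩ :=
    hK Jh Fh (extChartAt (𝓡 4) q q) r₁ ((r₁ + r₃) / 2) r₃ c hr₁ hr₂ hr₂' hc hJh hJh2 hFh hFpos
      hcert
  refine stub_glueFromChart S p J ε' F c q r₁ r₃
    ⟨hε', hball, hJ2, hJs, hJstd, hc, hr₁, hr₁₃, hrest⟩ ((r₁ + r₃) / 2) c' Jh' Fh' hr₂ hr₂' hc'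
    hJh' hJh'2 hFh'pos hcert' ?_
  intro x hx hxball v
  obtain ⟨hJx, hFx⟩ := hagree (extChartAt (𝓡 4) q x.1) hxball
  obtain ⟨hl1, hl2⟩ := hlink x hx hxball.1 v
  exact ⟨by rw [hJx]; exact hl1, by rw [hFx]; exact hl2⟩

/-- **The hyperbolic pair** (conclusion of the former `stub_hyperbolicPair`): glue applied to the
puncture certificate and the filling lemma. -/
theorem hyperbolicPair :
    ∀ (S : HomotopySphere 4) (p : S.carrier),
    ∃ (J : ∀ x : ↥(punctured p), TangentSpace (𝓡 4) x →L[ℝ] TangentSpace (𝓡 4) x) (ε' c : ℝ)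
      (F : ∀ x : ↥(punctured p), TangentSpace (𝓡 4) x → ℝ),
      0 < ε' ∧ Metric.closedBall (extChartAt (𝓡 4) p p) ε' ⊆ (extChartAt (𝓡 4) p).target ∧
      (∀ (x : ↥(punctured p)) (v : TangentSpace (𝓡 4) x), J x (J x v) = -v) ∧
      (∀ x₀ : ↥(punctured p), ContMDiffAt (𝓡 4)
        𝓘(ℝ, EuclideanSpace ℝ (Fin 4) →L[ℝ] EuclideanSpace ℝ (Fin 4)) ∞
        (inTangentCoordinates (𝓡 4) (𝓡 4) (id : ↥(punctured p) → ↥(punctured p)) id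
          (fun x => J x) x₀) x₀) ∧
      (∀ x : ↥(punctured p), InPuncturedChartBall p ε' x →
        ∀ (v : TangentSpace (𝓡 4) x) (b : EuclideanSpace ℝ (Fin 4)),
          inner ℝ (fderiv ℝ inversion (extChartAt (𝓡 4) p x.1 - extChartAt (𝓡 4) p p)
            (mfderiv (𝓡 4) 𝓘(ℝ, EuclideanSpace ℝ (Fin 4))
              (fun z : ↥(punctured p) => extChartAt (𝓡 4) p z.1) x (J x v))) b =
          stdSymplecticForm (fderiv ℝ inversion (extChartAt (𝓡 4) p x.1 - extChartAt (𝓡 4) p p)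
            (mfderiv (𝓡 4) 𝓘(ℝ, EuclideanSpace ℝ (Fin 4))
              (fun z : ↥(punctured p) => extChartAt (𝓡 4) p z.1) x v)) b) ∧
      0 < c ∧
      (∀ x : ↥(punctured p), ¬ InPuncturedChartBall p ε' x →
        ∀ v : TangentSpace (𝓡 4) x, 0 ≤ F x v ∧ (F x v = 0 → v = 0)) ∧
      (∀ (U : Set ℂ) (f : ℂ → ↥(punctured p)), IsOpen U →
        ContMDiffOn 𝓘(ℝ, ℂ) (𝓡 4) ∞ f U →
        (∀ z ∈ U, ∀ ζ : ℂ, mfderiv 𝓘(ℝ, ℂ) (𝓡 4) f z (Complex.I * ζ : ℂ) =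
          J (f z) (mfderiv 𝓘(ℝ, ℂ) (𝓡 4) f z (ζ : ℂ))) →
        (∀ z ∈ U, ¬ InPuncturedChartBall p ε' (f z)) →
        ContDiffOn ℝ 2 (fun w => F (f w) (mfderiv 𝓘(ℝ, ℂ) (𝓡 4) f w (1 : ℂ))) U ∧
        ∀ z ∈ U, 2 * c * (F (f z) (mfderiv 𝓘(ℝ, ℂ) (𝓡 4) f z (1 : ℂ))) ^ 3 ≤
          F (f z) (mfderiv 𝓘(ℝ, ℂ) (𝓡 4) f z (1 : ℂ)) *
              (Δ (fun w => F (f w) (mfderiv 𝓘(ℝ, ℂ) (𝓡 4) f w (1 : ℂ)))) z -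
            ((fderiv ℝ (fun w => F (f w) (mfderiv 𝓘(ℝ, ℂ) (𝓡 4) f w (1 : ℂ))) z 1) ^ 2 +
              (fderiv ℝ (fun w => F (f w) (mfderiv 𝓘(ℝ, ℂ) (𝓡 4) f w (1 : ℂ))) z Complex.I) ^ 2)) :=
  certificateGlue stub_punctureCertificate stub_certificateFill

/-- **Composition.** The stubs imply the crux `HyperbolicEnd` (by name; the stubs are used by
name inside the proof, as the skeleton audit requires): take `J, ε'` from the hyperbolic pair;
for `0 < ε < ε'` an entire `J`-curve avoiding `B_ε` avoids `B_ε'` (collar Liouville, fed with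
the flat Liouville stub), so its density satisfies the Ahlfors inequality on all of `ℂ` and is
`≥ 0`, hence vanishes (Ahlfors–Osserman); positivity of `F` gives `∂u/∂x ≡ 0`,
`J`-holomorphicity `du ≡ 0` (`mfderiv_eq_zero_of_apply_one_eq_zero`), and a `C¹` map with
vanishing differential on `ℂ` is constant (`apply_eq_apply_zero_of_mfderiv_eq_zero`),
contradicting non-constancy. -/
theorem HyperbolicEnd_of :
    Summit.SmoothPoincare4.SmoothPoincare4.Theses.SullivanDual.HyperbolicEnd := by
  intro S p
  obtain ⟨J, ε', c, F, hε', hball, hJ2, hJs, hJstd, hc, hF, hcurv⟩ := hyperbolicPair S p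
  refine ⟨J, ε', hε', hball, hJ2, hJs, hJstd, ?_⟩
  intro ε hε _hεε'
  rintro ⟨u, hu, hne, hhol, havoid⟩
  -- the curve avoids the larger ball (collar Liouville with `η = ε`)
  have havoid' : ∀ z, ¬ InPuncturedChartBall p ε' (u z) :=
    stub_collarLiouville stub_subMeanValueLiouville S p J ε' hε' hball hJstd u hu hne hhol
      ⟨ε, hε, havoid⟩
  -- its density satisfies the Ahlfors inequality on all of `ℂ`
  obtain ⟨hlam2, hineq⟩ := hcurv Set.univ u isOpen_univ hu.contMDiffOn
    (fun z _ ζ => hhol z ζ) (fun z _ => havoid' z)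
  set lam : ℂ → ℝ := fun z => F (u z) (mfderiv 𝓘(ℝ, ℂ) (𝓡 4) u z (1 : ℂ)) with hlam_def
  have hlamC : ContDiff ℝ 2 lam := contDiffOn_univ.1 hlam2
  have hlam0 : ∀ z, 0 ≤ lam z := fun z => (hF (u z) (havoid' z) _).1
  have hzero : ∀ z, lam z = 0 :=
    stub_ahlforsOsserman c lam hc hlamC hlam0 (fun z => hineq z (Set.mem_univ z))
  -- hence `∂u/∂x ≡ 0`, `du ≡ 0`, and `u` is constant
  have hdx : ∀ z, mfderiv 𝓘(ℝ, ℂ) (𝓡 4) u z (1 : ℂ) = 0 := fun z =>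
    (hF (u z) (havoid' z) _).2 (hzero z)
  have hd : ∀ z, mfderiv 𝓘(ℝ, ℂ) (𝓡 4) u z = 0 := fun z =>
    mfderiv_eq_zero_of_apply_one_eq_zero hhol (hdx z)
  obtain ⟨z, z', hzz'⟩ := hne
  exact hzz' ((apply_eq_apply_zero_of_mfderiv_eq_zero (hu.of_le (by norm_num)) hd z).trans
    (apply_eq_apply_zero_of_mfderiv_eq_zero (hu.of_le (by norm_num)) hd z').symm)

end Summit.SmoothPoincare4.SmoothPoincare4.Cruxes.HyperbolicEnd.Sketch

end

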